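import Summits.AtomisticToContinuum.BoseEinsteinCondensation.Theses.BECHeatBathGap
import Summits.AtomisticToContinuum.BoseEinsteinCondensation.Theorems.BECHeatBathGapSquareSummableInfluenceLeastSquaresLeaf
import Literature.MathematicalPhysics.QuantumManyBody.GroundState

/-!
# Skeleton v4 (lead c5) — crux `SquareSummableInfluence` (stmt-AtomisticToContinuum-14368), line `registered`/`birth`

Route `BECHeatBathGap`, crux #3 (card A2, Dirichlet frame). Same composition idea as v2/v3 (physics at the
ground states ∘ `L²`-continuity of the influence sum ∘ compactness at fixed `N`), with the one physics stub
RE-TYPED in its quantifier-minimal, PREDICTOR-FREE form (lead c5, landed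
`Theorems/BECHeatBathGapSquareSummableInfluenceLeastSquares{,Leaf}.lean`): the infimum over bounded
measurable blind predictors `g_i` of `∫_{Λ^{N+1}} |Ψ₀ − g_i Θ₀(tail)|²` is ATTAINED in closed form by the
fibrewise conditional least-squares amplitude
`g⋆_i(Z) = ∫ conj Θ₀(tail Z^{i→x}) Ψ₀(Z^{i→x}) dx / ∫ |Θ₀(tail Z^{i→x})|² dx`
(`lintegral_sub_leastSquares_mul_tail_sq_le` + `exists_bounded_blind_lintegral_le_leastSquares_add`), so v3's
`stub_allGroundStatesInfluence` (`∀Θ₀ ∃Ψ₀ ∃g ∃M, …`) is EQUIVALENT (`allGroundStatesInfluence_iff_leastSquares`)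
to

* `stub_leastSquaresInfluence` (XL — the whole physics of A2, held by the lead): at low density and eventually
  in `N`, every `N`-body Dirichlet ground state `Θ₀` in the box of side `L' = ((N+1)/ρ)^{1/3}` admits an
  `(N+1)`-body ground state `Ψ₀` in the same box with total LEAST-SQUARES single-bath-particle influence
  `∑_i ∫_{Λ^{N+1}} |Ψ₀ − g⋆_i Θ₀(tail)|² ≤ ε`. For `Θ₀ > 0` (every `v` finite a.e.) this is the conditional-variance
  / operator form `∑_i ∫dy E_{Θ₀²}[Var_i(Ψ₀(y,·)/Θ₀)] = Tr(Γ_X G_{Θ₀}) ≤ ε` (`G_{Θ₀} = ∑_i(1 − P_i)` the heat-bath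
  Dirichlet form of `|Θ₀|²` over particle labels, `Γ_X` the `N`-body reduced state of `Ψ₀`; lead c4), equivalently
  the RESAMPLING form `½ ∑_i E ∫dy |h(y,X) − h(y,X^{(i)})|² ≤ ε·‖Ψ₀‖²`-normalised, `h = Ψ₀/Θ₀`, `X^{(i)}` = `X` with
  `x_i` redrawn from its conditional law given the other bath particles: one heat-bath move changes the insertion
  amplitude by a square-summable amount (physically the dressed pair factor `u_eff(y − x_i)`: core + `a/r` to the
  healing length + Reatto–Chester `r⁻²` tail, `I ≈ 10.6 √(ρa³)`).

`SquareSummableInfluence_of : SquareSummableInfluence` (the crux BY NAME; sorry-free modulo the stub): the landed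
`squareSummableInfluence_of_leastSquaresForm` (lead c5: `allGroundStatesInfluence_iff_leastSquares` then the v3
reduction `squareSummableInfluence_of_allGroundStatesForm`, p156111 — uniform slack window by compactness, then
the ground-state form of the crux, p153840). STATUS (lead c5): the stub is the crux read at the ground states
(c2–c4), now with no quantifier over predictors; open-problem class (N-uniform `L²` control of the one-bath-particle
response of `Ψ₀^{(N+1)}/Θ₀^{(N)}` at fixed density — the `T = 0` infrared structure of the interacting ground state,
barrier `BogoliubovPerturbationInfrared`). See `Cruxes/SquareSummableInfluence/Lines/registered-status-c5.md`.
-/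

noncomputable section

open MeasureTheory Filter
open scoped ENNReal NNReal Topology ComplexConjugate

namespace Summit.AtomisticToContinuum.BoseEinsteinCondensation.Cruxes.SquareSummableInfluence.Birth

open Literature.MathematicalPhysics.QuantumManyBody.BoseGas
open Summit.AtomisticToContinuum.BoseEinsteinCondensation.Theorems.SquareSummableInfluence

/-- **Stub (XL, the physics of A2, predictor-free least-squares form): square-summable least-squares
influence of the TRUE ground states.** For repulsive finite-range `v` and `ε > 0`, at low density and
eventually in `N`, every ground state `Θ₀` of `N` bodies in the Dirichlet box of side `((N+1)/ρ)^{1/3}` admits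
a ground state `Ψ₀` of `N+1` bodies in the same box whose total least-squares single-bath-particle influence
`∑_i ∫_{Λ^{N+1}} |Ψ₀(Z) − g⋆_i(Z) Θ₀(tail Z)|²` is `≤ ε`, where
`g⋆_i(Z) = ∫_Λ conj Θ₀(tail Z^{i→x}) Ψ₀(Z^{i→x}) dx / ∫_Λ |Θ₀(tail Z^{i→x})|² dx` is the conditional least-squares
amplitude on the fibre of the bath coordinate `x_i = Z (succ i)` (orthogonal projection onto `ℂ Θ₀(tail Z^{i→·})`
in `L²(Λ, dx_i)`; `= 0` on fibres of zero `Θ₀`-mass). Physically: resampling one bath particle from its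
conditional law changes the insertion amplitude `Ψ₀/Θ₀` by the dressed pair factor `u_eff(y − x_i)` — core +
`a/r` to the healing length + Reatto–Chester `r⁻²` tail, each square-integrable in `d = 3`, total `≈ 10.6 √(ρa³)`.
[cite: ReattoChester1967; Reatto1969; Mayers2001; LiebSeiringerSolovejYngvason2005, §1.2] -/
theorem stub_leastSquaresInfluence :
    ∀ v : ℝ → ℝ≥0∞, IsRepulsiveFiniteRange v → ∀ ε : ℝ, 0 < ε →
      ∃ ρ₀ : ℝ, 0 < ρ₀ ∧ ∀ ρ : ℝ, 0 < ρ → ρ < ρ₀ → ∀ᶠ N : ℕ in atTop,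
        ∀ Θ₀ : Config N → ℂ, IsGroundState v (sideLength ρ (N + 1)) Θ₀ →
          ∃ Ψ₀ : Config (N + 1) → ℂ, IsGroundState v (sideLength ρ (N + 1)) Ψ₀ ∧
            (∑ i : Fin N, ∫⁻ Z in boxN (N + 1) (sideLength ρ (N + 1)),
              (‖Ψ₀ Z -
                ((∫ x in box (sideLength ρ (N + 1)), conj (Θ₀ (Matrix.vecTail (Function.update Z (Fin.succ i) x))) *
                  Ψ₀ (Function.update Z (Fin.succ i) x)) /
                (((∫⁻ x in box (sideLength ρ (N + 1)),
                    (‖Θ₀ (Matrix.vecTail (Function.update Z (Fin.succ i) x))‖₊ : ℝ≥0∞) ^ 2).toReal : ℝ) : ℂ)) *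
                  Θ₀ (Matrix.vecTail Z)‖₊ : ℝ≥0∞) ^ 2) ≤ ENNReal.ofReal ε := by
  sorry

/-- **Composition (sorry-free): the crux `SquareSummableInfluence`, concluded BY NAME from the one declared
stub used BY NAME** (the `#h21_check_skeleton` shape: the stub is its first `have`). The landed
`squareSummableInfluence_of_leastSquaresForm` (lead c5; = `allGroundStatesInfluence_iff_leastSquares` ∘
`squareSummableInfluence_of_allGroundStatesForm`) turns the predictor-free least-squares form into the crux. -/
theorem SquareSummableInfluence_of :
    Summit.AtomisticToContinuum.BoseEinsteinCondensation.Theses.BECHeatBathGap.SquareSummableInfluence := by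
  have h1 := stub_leastSquaresInfluence
  exact squareSummableInfluence_of_leastSquaresForm h1

end Summit.AtomisticToContinuum.BoseEinsteinCondensation.Cruxes.SquareSummableInfluence.Birth

end
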